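import Summits.ABC.ABC.Theses.ExceptionalSetEnergy
import Literature.NumberTheory.DiophantineGeometry.AbcExceptionalSetBounds

/-!
# Crux `CountingForm` (stmt-ABC-2707) — split census, kernel certificates

Companion of `Cruxes/CountingForm/STRATEGY-CENSUS.md` (crux-strategist, RESTATED re-audit of
route `ABC/ExceptionalSetEnergy`, 2026-08-17). `CountingForm` is the counting form of abc
(`∀ l < 1, N_l(X) = O(1)`, `N_l = abcExponentCount l`). For the candidate decompositions
`X₁ ∧ … ∧ X_k → CountingForm` examined in the census this file certifies either the (c)-violation
(a piece is provably EQUIVALENT to the crux: D1 `highRange_iff`, D2 `step_iff`) or the triviality of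
the seam (D3 `countingForm_of_partition`, the bare union bound), and it PROVES the one assembly that
passes the letter of (a)(b)(c) — the sector split D*
`ProductForm ∧ PowerDeepForm → CountingForm`
(`countingForm_of_productForm_of_powerDeepForm`): Szpiro `6+ε` for the Frey curves of all
triples in counting currency (`rad(abc) < (abc)^μ`, `μ < 1/3`, boundedly often) plus abc on the
power-deep sector `min(a,b) ≤ c^{1-η}` (every `η > 0`), patched by `abc > c^{3-2η}` off the sector.
D* is the counting-currency form of the kernel-checked record
`Cruxes/CompactBalanceTransfer/StrategySplitP1.lean` §3 (`abc_of_freySzpiro_of_powerDeep`,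
`freySzpiroToABC_iff_powerDeep`; census of stmt-ABC-1725, D5) — not new mathematics. Also proved:
`countingForm_of_ABC` (the summit implies the crux; with the route's Assembly item 2715 this is the
judge's `CountingForm ≡ ABC`), `productForm_of_ABC`, `powerDeepForm_of_ABC` (both pieces are
consequences of the summit), `productForm_of_productIneq` (inequality currency ⟹ counting currency).

Nothing here is a route item or a Theorems landing; it is evidence (crux workfile). `lean check`:
rc 0, 0 sorries.
-/

set_option linter.dupNamespace false
set_option maxHeartbeats 800000

open Literature.NumberTheory.DiophantineGeometry

namespace Summit.ABC.ABC.Cruxes.CountingForm.SplitCensus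

open Summit.ABC.ABC.Theses.ExceptionalSetEnergy

/-! ## 0. The crux unfolded -/

/-- `CountingForm` is literally `∀ l < 1, ∃ B, ∀ X, N_l(X) ≤ B`. -/
theorem countingForm_iff :
    CountingForm ↔ ∀ l : ℝ, l < 1 → ∃ B : ℕ, ∀ X : ℕ, abcExponentCount l X ≤ B := Iff.rfl

/-- The level-`l` boundedness predicate `Bdd l := ∃ B, ∀ X, N_l(X) ≤ B`. -/
def Bdd (l : ℝ) : Prop := ∃ B : ℕ, ∀ X : ℕ, abcExponentCount l X ≤ B

theorem countingForm_iff_bdd : CountingForm ↔ ∀ l : ℝ, l < 1 → Bdd l := Iff.rfl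

/-- `Bdd` is downward monotone in the level (the exceptional sets are nested in `l`). -/
theorem bdd_mono {l m : ℝ} (h : l ≤ m) (hm : Bdd m) : Bdd l := by
  obtain ⟨B, hB⟩ := hm
  exact ⟨B, fun X => (abcExponentCount_mono_left h X).trans (hB X)⟩

/-- Levels `l ≤ 0` are trivially bounded (the sets are empty). -/
theorem bdd_of_nonpos {l : ℝ} (hl : l ≤ 0) : Bdd l :=
  ⟨0, fun X => (abcExponentCount_eq_zero_of_nonpos hl X).le⟩

/-! ## D1. Range split `CountingForm ⟸ LowRange l₀ ∧ HighRange l₀` — the high piece IS the crux -/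

/-- The "high-range" piece of a split of the levels at `l₀`: boundedness for `l₀ ≤ l < 1`. -/
def HighRange (l₀ : ℝ) : Prop := ∀ l : ℝ, l₀ ≤ l → l < 1 → Bdd l

/-- The "low-range" piece: boundedness for `l < l₀`. -/
def LowRange (l₀ : ℝ) : Prop := ∀ l : ℝ, l < l₀ → Bdd l

/-- (c)-violation certificate for D1: for every cut `l₀ < 1` the high piece alone implies the crux
(monotonicity in `l`), so `HighRange l₀ ↔ CountingForm` and `LowRange l₀` is not load-bearing. -/
theorem highRange_iff {l₀ : ℝ} (h₀ : l₀ < 1) : HighRange l₀ ↔ CountingForm := by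
  constructor
  · intro h l hl
    by_cases hle : l₀ ≤ l
    · exact h l hle hl
    · exact bdd_mono (le_of_not_ge hle) (h l₀ le_rfl h₀)
  · intro h l _ hl
    exact h l hl

/-- … and for the cut `l₀ = 1` the low piece is the crux verbatim. -/
theorem lowRange_one_iff : LowRange 1 ↔ CountingForm := Iff.rfl


/-! ## D2. Instalments `Step : Bdd l → Bdd ((1+l)/2)` — a single piece that IS the crux -/

/-- The "instalment" piece: boundedness at level `l` propagates to level `(1+l)/2` (the level reached
by the squaring map `(a,b,c) ↦ ((b-a)², 4ab, c²)` — here asserted in the HARD direction). -/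
def Step : Prop := ∀ l : ℝ, l < 1 → Bdd l → Bdd ((1 + l) / 2)

/-- The dyadic levels `1 - (1/2)^n` are all bounded under `Step` (induction from the empty level 0). -/
theorem bdd_dyadic_of_step (h : Step) (n : ℕ) : Bdd (1 - (1 / 2 : ℝ) ^ n) := by
  induction n with
  | zero => exact bdd_of_nonpos (by norm_num)
  | succ n ih =>
    have hlt : 1 - (1 / 2 : ℝ) ^ n < 1 := by
      have : (0 : ℝ) < (1 / 2 : ℝ) ^ n := by positivity
      linarith
    have := h _ hlt ih
    convert this using 2
    rw [pow_succ]
    ring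

/-- (a)/(c)-violation certificate for D2: `Step` alone is equivalent to the crux (k = 1; the piece is
abc "in instalments"). -/
theorem step_iff : Step ↔ CountingForm := by
  constructor
  · intro h l hl
    obtain ⟨n, hn⟩ := exists_pow_lt_of_lt_one (sub_pos.mpr hl) (by norm_num : (1 / 2 : ℝ) < 1)
    exact bdd_mono (by linarith) (bdd_dyadic_of_step h n)
  · intro h l hl _
    exact h _ (by linarith)

/-! ## D3. Class partitions `CountingForm ⟸ ClassForm P ∧ ClassForm ¬P` — the seam is a union bound -/

/-- The exceptional set at level `l` up to `X` (the set whose `ncard` is `abcExponentCount l X`). -/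
def excSet (l : ℝ) (X : ℕ) : Set (ℕ × ℕ × ℕ) :=
  {t | IsABCTriple t.1 t.2.1 t.2.2 ∧ t.2.2 ≤ X ∧
    ((rad t.1 t.2.1 t.2.2 : ℕ) : ℝ) < (t.2.2 : ℝ) ^ l}

theorem abcExponentCount_eq (l : ℝ) (X : ℕ) : abcExponentCount l X = (excSet l X).ncard := rfl

theorem excSet_finite (l : ℝ) (X : ℕ) : (excSet l X).Finite := abcExponentCount_finite l X

/-- abc restricted to a class `P` of triples, in counting form. -/
def ClassForm (P : ℕ × ℕ × ℕ → Prop) : Prop :=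
  ∀ l : ℝ, l < 1 → ∃ B : ℕ, ∀ X : ℕ, ({t | P t} ∩ excSet l X).ncard ≤ B

/-- (b)-certificate for D3: the assembly of a class partition is the union bound and nothing else
(no interaction between the pieces). Quoted in the census as the "trivial seam". -/
theorem countingForm_of_partition (P : ℕ × ℕ × ℕ → Prop) (h₁ : ClassForm P)
    (h₂ : ClassForm fun t => ¬ P t) : CountingForm := by
  intro l hl
  obtain ⟨B₁, hB₁⟩ := h₁ l hl
  obtain ⟨B₂, hB₂⟩ := h₂ l hl
  refine ⟨B₁ + B₂, fun X => ?_⟩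
  show (excSet l X).ncard ≤ B₁ + B₂
  have hcover : excSet l X ⊆ ({t | P t} ∩ excSet l X) ∪ ({t | ¬ P t} ∩ excSet l X) := by
    intro t ht
    by_cases hP : P t
    · exact Or.inl ⟨hP, ht⟩
    · exact Or.inr ⟨hP, ht⟩
  calc (excSet l X).ncard
      ≤ (({t | P t} ∩ excSet l X) ∪ ({t | ¬ P t} ∩ excSet l X)).ncard :=
        Set.ncard_le_ncard hcover (((excSet_finite l X).subset Set.inter_subset_right).union
          ((excSet_finite l X).subset Set.inter_subset_right))
    _ ≤ _ := Set.ncard_union_le _ _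
    _ ≤ B₁ + B₂ := Nat.add_le_add (hB₁ X) (hB₂ X)

/-- Conversely every class piece is implied by the crux (each is a sub-count). -/
theorem classForm_of_countingForm (P : ℕ × ℕ × ℕ → Prop) (h : CountingForm) : ClassForm P := by
  intro l hl
  obtain ⟨B, hB⟩ := h l hl
  exact ⟨B, fun X => (Set.ncard_le_ncard Set.inter_subset_right (excSet_finite l X)).trans
    ((abcExponentCount_eq l X) ▸ hB X)⟩


/-! ## D*. The sector split `CountingForm ⟸ ProductForm ∧ PowerDeepForm` — PROVED assembly

`ProductForm` is Szpiro's conjecture for Frey curves in counting form (`|Δ_min| ≪ N^{6+ε}` for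
`y² = x(x-a)(x+b)` reads `(abc)² ≪ rad(abc)^{6+ε}`, i.e. finitely many abc triples with
`rad(abc) < (abc)^μ` for each `μ < 1/3`); `PowerDeepForm` is abc restricted to the power-deep sector
`min(a,b) ≤ c^{1-η}` (every `η > 0`). Patching inequality: off the power-deep sector `abc > c^{3-2η}`, so an
`l`-exceptional balanced triple is `μ`-product-exceptional with `μ = l/(2+l) < 1/3` (`η = (1-l)/2`). -/

/-- The product-exceptional set: abc triples `c ≤ X` with `rad(abc) < (abc)^μ`. -/
def prodExcSet (μ : ℝ) (X : ℕ) : Set (ℕ × ℕ × ℕ) :=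
  {t | IsABCTriple t.1 t.2.1 t.2.2 ∧ t.2.2 ≤ X ∧
    ((rad t.1 t.2.1 t.2.2 : ℕ) : ℝ) < ((t.1 * t.2.1 * t.2.2 : ℕ) : ℝ) ^ μ}

theorem prodExcSet_finite (μ : ℝ) (X : ℕ) : (prodExcSet μ X).Finite := by
  refine ((Set.finite_Iic X).prod ((Set.finite_Iic X).prod (Set.finite_Iic X))).subset ?_
  rintro ⟨a, b, c⟩ ⟨⟨ha, hb, habc, -⟩, hcX, -⟩
  simp only [Set.mem_prod, Set.mem_Iic] at *
  omega

/-- **Szpiro's conjecture for Frey curves, counting form** (`ProductForm`): for every `μ < 1/3` the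
abc triples with `rad(abc) < (abc)^μ` are boundedly many. Equivalent to `∀ ε, (abc) ≤ C_ε rad(abc)^{3+ε}`,
i.e. to `|Δ_min(E_{a,b,c})| ≪_ε N^{6+ε}` (Szpiro 1983 restricted to Frey–Hellegouarch curves; the tree's
`Cruxes/CompactBalanceTransfer/StrategySplitP1.FreySzpiroAll` with `ε ↦ 2ε`); implied by abc
(`productForm_of_ABC` below); implies abc only with exponent `3/2`
(`StrategySplitP1.abc_threeHalves_of_freySzpiro`; Vojta 1987 App. ABC; Bombieri–Gubler §12.5). -/
def ProductForm : Prop := ∀ μ : ℝ, μ < 1 / 3 → ∃ B : ℕ, ∀ X : ℕ, (prodExcSet μ X).ncard ≤ B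

/-- The power-deep-sector exceptional set: `l`-exceptional abc triples `c ≤ X` with `min(a,b) ≤ c^{1-η}`. -/
def powerDeepExcSet (η l : ℝ) (X : ℕ) : Set (ℕ × ℕ × ℕ) :=
  {t | IsABCTriple t.1 t.2.1 t.2.2 ∧ t.2.2 ≤ X ∧
    ((rad t.1 t.2.1 t.2.2 : ℕ) : ℝ) < (t.2.2 : ℝ) ^ l ∧ ((min t.1 t.2.1 : ℕ) : ℝ) ≤ (t.2.2 : ℝ) ^ (1 - η)}

theorem powerDeepExcSet_subset (η l : ℝ) (X : ℕ) : powerDeepExcSet η l X ⊆ excSet l X :=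
  fun _ ht => ⟨ht.1, ht.2.1, ht.2.2.1⟩

/-- **abc on the power-deep sector** (`PowerDeepForm`): for every `η > 0` and `l < 1` the `l`-exceptional
abc triples with `min(a,b) ≤ c^{1-η}` are boundedly many (the counting form of
`StrategySplitP1.PowerDeepABC δ` for all `δ > 0`). A restriction of the crux (so implied by it:
`powerDeepForm_of_countingForm`); not known to imply it; no plan/engine to `1+ε` (census §3, D* (d)). -/
def PowerDeepForm : Prop :=
  ∀ η : ℝ, 0 < η → ∀ l : ℝ, l < 1 → ∃ B : ℕ, ∀ X : ℕ, (powerDeepExcSet η l X).ncard ≤ B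

theorem powerDeepForm_of_countingForm (h : CountingForm) : PowerDeepForm := by
  intro η _ l hl
  obtain ⟨B, hB⟩ := h l hl
  exact ⟨B, fun X => (Set.ncard_le_ncard (powerDeepExcSet_subset η l X) (excSet_finite l X)).trans
    ((abcExponentCount_eq l X) ▸ hB X)⟩

/-- The patching inequality: off the power-deep sector, `c^{3-2η} < abc`. -/
theorem rpow_lt_prod_of_balanced {a b c : ℕ} {η : ℝ} (hc : 0 < c)
    (ha : (c : ℝ) ^ (1 - η) < a) (hb : (c : ℝ) ^ (1 - η) < b) :
    (c : ℝ) ^ (3 - 2 * η) < (a : ℝ) * b * c := by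
  have hcpos : (0 : ℝ) < c := by exact_mod_cast hc
  have hsplit : (c : ℝ) ^ (3 - 2 * η) = (c : ℝ) ^ (1 - η) * (c : ℝ) ^ (1 - η) * (c : ℝ) ^ (1 : ℝ) := by
    rw [← Real.rpow_add hcpos, ← Real.rpow_add hcpos]
    congr 1
    ring
  rw [hsplit, Real.rpow_one]
  have h0 : (0 : ℝ) ≤ (c : ℝ) ^ (1 - η) := Real.rpow_nonneg hcpos.le _
  exact mul_lt_mul_of_pos_right (mul_lt_mul'' ha hb h0 h0) hcpos

/-- The covering behind the sector split: with `η = (1-l)/2` and `μ = l/(2+l)`, every `l`-exceptional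
triple is power-deep-sector-exceptional or `μ`-product-exceptional. -/
theorem excSet_subset_powerDeep_union_prod {l : ℝ} (hl0 : 0 < l) (X : ℕ) :
    excSet l X ⊆ powerDeepExcSet ((1 - l) / 2) l X ∪ prodExcSet (l / (2 + l)) X := by
  rintro ⟨a, b, c⟩ ⟨ht, hcX, hrad⟩
  by_cases hmin : ((min a b : ℕ) : ℝ) ≤ (c : ℝ) ^ (1 - (1 - l) / 2)
  · exact Or.inl ⟨ht, hcX, hrad, hmin⟩
  · refine Or.inr ⟨ht, hcX, ?_⟩
    obtain ⟨ha0, hb0, habc, -⟩ := ht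
    simp only at habc hrad hmin ⊢
    push Not at hmin
    have hc : 0 < c := by omega
    have hcpos : (0 : ℝ) < c := by exact_mod_cast hc
    have ha : (c : ℝ) ^ (1 - (1 - l) / 2) < a :=
      hmin.trans_le (by exact_mod_cast min_le_left a b)
    have hb : (c : ℝ) ^ (1 - (1 - l) / 2) < b :=
      hmin.trans_le (by exact_mod_cast min_le_right a b)
    have hprod := rpow_lt_prod_of_balanced (η := (1 - l) / 2) hc ha hb
    have hμpos : 0 < l / (2 + l) := div_pos hl0 (by linarith)
    have hexp : (c : ℝ) ^ l = ((c : ℝ) ^ (3 - 2 * ((1 - l) / 2))) ^ (l / (2 + l)) := by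
      rw [← Real.rpow_mul hcpos.le]
      congr 1
      field_simp
      ring
    calc ((rad a b c : ℕ) : ℝ) < (c : ℝ) ^ l := hrad
      _ = ((c : ℝ) ^ (3 - 2 * ((1 - l) / 2))) ^ (l / (2 + l)) := hexp
      _ < ((a : ℝ) * b * c) ^ (l / (2 + l)) :=
          Real.rpow_lt_rpow (Real.rpow_nonneg hcpos.le _) hprod hμpos
      _ = ((a * b * c : ℕ) : ℝ) ^ (l / (2 + l)) := by push_cast; ring_nf

/-- **D* assembly, PROVED.** Szpiro-for-Frey-curves (counting form) and abc on the power-deep sector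
together give the crux. The only split of `CountingForm` found that passes the letter of (a)(b)(c):
both pieces used, the seam is a genuine patching inequality, neither piece is known to be
equivalent to the crux or to `ABC` (census §3, D*; probes `bc/`). -/
theorem countingForm_of_productForm_of_powerDeepForm (hP : ProductForm) (hU : PowerDeepForm) :
    CountingForm := by
  intro l hl
  by_cases hl0 : l ≤ 0
  · exact bdd_of_nonpos hl0
  push Not at hl0
  have hη : 0 < (1 - l) / 2 := by linarith
  have hμ : l / (2 + l) < 1 / 3 := by
    rw [div_lt_iff₀ (by linarith : (0 : ℝ) < 2 + l)]
    linarith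
  obtain ⟨B₁, hB₁⟩ := hU _ hη l hl
  obtain ⟨B₂, hB₂⟩ := hP _ hμ
  refine ⟨B₁ + B₂, fun X => ?_⟩
  show (excSet l X).ncard ≤ B₁ + B₂
  calc (excSet l X).ncard
      ≤ (powerDeepExcSet ((1 - l) / 2) l X ∪ prodExcSet (l / (2 + l)) X).ncard :=
        Set.ncard_le_ncard (excSet_subset_powerDeep_union_prod hl0 X)
          (((excSet_finite l X).subset (powerDeepExcSet_subset _ l X)).union (prodExcSet_finite _ X))
    _ ≤ _ := Set.ncard_union_le _ _
    _ ≤ B₁ + B₂ := Nat.add_le_add (hB₁ X) (hB₂ X)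


/-! ## S ⟹ X and S ⟹ pieces: the crux and both pieces are CONSEQUENCES of the summit

`countingForm_of_ABC` is the direction NOT filed in the route (the route's Assembly item 2715 is
`CountingForm → ABC`); together they certify the judge's verdict `CountingForm ≡ ABC`. -/

/-- Size bound behind `ABC → CountingForm`: under the abc inequality with exponent `1+ε`,
`l (1+ε) < 1`, an `l`-exceptional triple has `c < C^{1/(1-l(1+ε))}`. -/
theorem lt_of_abcIneq_of_exceptional {l ε C : ℝ} {a b c : ℕ} (hc0 : 0 < c) (hε : 0 < 1 + ε)
    (hlε : l * (1 + ε) < 1)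
    (habc : (c : ℝ) < C * ((rad a b c : ℕ) : ℝ) ^ (1 + ε))
    (hrad : ((rad a b c : ℕ) : ℝ) < (c : ℝ) ^ l) :
    (c : ℝ) < C ^ (1 / (1 - l * (1 + ε))) := by
  have hcpos : (0 : ℝ) < c := by exact_mod_cast hc0
  have hrad0 : (0 : ℝ) ≤ ((rad a b c : ℕ) : ℝ) := Nat.cast_nonneg _
  -- rad^(1+ε) < c^(l(1+ε))
  have h1 : ((rad a b c : ℕ) : ℝ) ^ (1 + ε) < (c : ℝ) ^ (l * (1 + ε)) := by
    rw [Real.rpow_mul hcpos.le]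
    exact Real.rpow_lt_rpow hrad0 hrad hε
  -- so c < C · c^(l(1+ε)), hence C > 0 and c^(1 - l(1+ε)) < C
  have hC : 0 < C := by
    by_contra hC
    push Not at hC
    have : C * ((rad a b c : ℕ) : ℝ) ^ (1 + ε) ≤ 0 :=
      mul_nonpos_of_nonpos_of_nonneg hC (Real.rpow_nonneg hrad0 _)
    linarith
  have h2 : (c : ℝ) < C * (c : ℝ) ^ (l * (1 + ε)) :=
    habc.trans (mul_lt_mul_of_pos_left h1 hC)
  have hsplit : (c : ℝ) = (c : ℝ) ^ (1 - l * (1 + ε)) * (c : ℝ) ^ (l * (1 + ε)) := by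
    rw [← Real.rpow_add hcpos]
    simp
  have hpow_pos : (0 : ℝ) < (c : ℝ) ^ (l * (1 + ε)) := Real.rpow_pos_of_pos hcpos _
  have h2' : (c : ℝ) ^ (1 - l * (1 + ε)) * (c : ℝ) ^ (l * (1 + ε)) < C * (c : ℝ) ^ (l * (1 + ε)) := by
    rw [← hsplit]; exact h2
  have h3 : (c : ℝ) ^ (1 - l * (1 + ε)) < C := lt_of_mul_lt_mul_right h2' hpow_pos.le
  have hδ : 0 < 1 - l * (1 + ε) := by linarith
  have h4 := Real.rpow_lt_rpow (Real.rpow_nonneg hcpos.le _) h3 (one_div_pos.mpr hδ)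
  rwa [← Real.rpow_mul hcpos.le, mul_one_div_cancel hδ.ne', Real.rpow_one] at h4

/-- **`ABC → CountingForm`** (the summit implies the crux; CONDITIONAL on the hypothesis `habc : ABC`,
so this is not a proof of the item): under abc with `ε = (1-l)/(2l)` every `l`-exceptional triple has
`c ≤ M(l)`, so `N_l(X) ≤ N_l(M)` for all `X`. -/
theorem countingForm_of_ABC (habc : _root_.ABC) : CountingForm := by
  intro l hl
  by_cases hl0 : l ≤ 0
  · exact bdd_of_nonpos hl0
  push Not at hl0
  set ε : ℝ := (1 - l) / (2 * l) with hε_def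
  have hε : 0 < ε := div_pos (by linarith) (by linarith)
  have hlε : l * (1 + ε) < 1 := by
    have hl0' : l ≠ 0 := hl0.ne'
    have : l * (1 + ε) = (1 + l) / 2 := by
      rw [hε_def]; field_simp; ring
    rw [this]; linarith
  obtain ⟨C, -, hC⟩ := habc ε hε
  set M : ℕ := ⌈C ^ (1 / (1 - l * (1 + ε)))⌉₊ with hM
  refine ⟨abcExponentCount l M, fun X => ?_⟩
  show (excSet l X).ncard ≤ (excSet l M).ncard
  refine Set.ncard_le_ncard ?_ (excSet_finite l M)
  rintro ⟨a, b, c⟩ ⟨ht, -, hrad⟩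
  refine ⟨ht, ?_, hrad⟩
  obtain ⟨ha, hb, habc', hcop⟩ := ht
  simp only at habc' hrad ⊢
  have hc0 : 0 < c := by omega
  have hlt := lt_of_abcIneq_of_exceptional hc0 (by linarith) hlε (hC a b c ⟨ha, hb, habc', hcop⟩) hrad
  have : (c : ℝ) ≤ (M : ℝ) := hlt.le.trans (Nat.le_ceil _)
  exact_mod_cast this

/-- For `μ ≤ 0` there are no product-exceptional triples (`(abc)^μ ≤ 1 ≤ rad`). -/
theorem prodExcSet_eq_empty_of_nonpos {μ : ℝ} (hμ : μ ≤ 0) (X : ℕ) : prodExcSet μ X = ∅ := by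
  rw [Set.eq_empty_iff_forall_notMem]
  rintro ⟨a, b, c⟩ ⟨⟨ha, hb, habc, -⟩, -, hlt⟩
  simp only at habc hlt
  have h1 : (1 : ℝ) ≤ ((a * b * c : ℕ) : ℝ) := by
    have : 0 < a * b * c := Nat.mul_pos (Nat.mul_pos ha hb) (by omega)
    exact_mod_cast Nat.one_le_iff_ne_zero.mpr this.ne'
  have hrad : (1 : ℝ) ≤ (rad a b c : ℕ) := by
    exact_mod_cast Nat.one_le_iff_ne_zero.mpr
      (by rw [rad_def]; exact UniqueFactorizationMonoid.radical_ne_zero)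
  exact absurd (hlt.trans_le (Real.rpow_le_one_of_one_le_of_nonpos h1 hμ)) (not_lt.mpr hrad)

/-- Szpiro-for-Frey-curves as an INEQUALITY (`(abc) < C_ε rad(abc)^{3+ε}`), the form in which the
elliptic-curve literature states it (`|Δ_min| ≪ N^{6+ε}` on `y² = x(x-a)(x+b)`). -/
def ProductIneq : Prop :=
  ∀ ε : ℝ, 0 < ε → ∃ C : ℝ, ∀ a b c : ℕ, IsABCTriple a b c →
    ((a * b * c : ℕ) : ℝ) < C * ((rad a b c : ℕ) : ℝ) ^ (3 + ε)

/-- Size bound behind `ProductIneq → ProductForm`: with `μ (3+ε) < 1`, a `μ`-product-exceptional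
triple has `abc < C^{1/(1-μ(3+ε))}`. -/
theorem prod_lt_of_productIneq_of_exceptional {μ ε C : ℝ} {a b c : ℕ} (habc0 : 0 < a * b * c)
    (hε : 0 < 3 + ε) (hμε : μ * (3 + ε) < 1)
    (hineq : ((a * b * c : ℕ) : ℝ) < C * ((rad a b c : ℕ) : ℝ) ^ (3 + ε))
    (hrad : ((rad a b c : ℕ) : ℝ) < ((a * b * c : ℕ) : ℝ) ^ μ) :
    ((a * b * c : ℕ) : ℝ) < C ^ (1 / (1 - μ * (3 + ε))) := by
  set P : ℝ := ((a * b * c : ℕ) : ℝ) with hP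
  have hPpos : 0 < P := by rw [hP]; exact_mod_cast habc0
  have hrad0 : (0 : ℝ) ≤ ((rad a b c : ℕ) : ℝ) := Nat.cast_nonneg _
  have h1 : ((rad a b c : ℕ) : ℝ) ^ (3 + ε) < P ^ (μ * (3 + ε)) := by
    rw [Real.rpow_mul hPpos.le]
    exact Real.rpow_lt_rpow hrad0 hrad hε
  have hC : 0 < C := by
    by_contra hC
    push Not at hC
    have : C * ((rad a b c : ℕ) : ℝ) ^ (3 + ε) ≤ 0 :=
      mul_nonpos_of_nonpos_of_nonneg hC (Real.rpow_nonneg hrad0 _)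
    linarith
  have h2 : P < C * P ^ (μ * (3 + ε)) := hineq.trans (mul_lt_mul_of_pos_left h1 hC)
  have hsplit : P = P ^ (1 - μ * (3 + ε)) * P ^ (μ * (3 + ε)) := by
    rw [← Real.rpow_add hPpos]; simp
  have hpow_pos : (0 : ℝ) < P ^ (μ * (3 + ε)) := Real.rpow_pos_of_pos hPpos _
  have h2' : P ^ (1 - μ * (3 + ε)) * P ^ (μ * (3 + ε)) < C * P ^ (μ * (3 + ε)) := by
    rw [← hsplit]; exact h2
  have h3 : P ^ (1 - μ * (3 + ε)) < C := lt_of_mul_lt_mul_right h2' hpow_pos.le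
  have hδ : 0 < 1 - μ * (3 + ε) := by linarith
  have h4 := Real.rpow_lt_rpow (Real.rpow_nonneg hPpos.le _) h3 (one_div_pos.mpr hδ)
  rwa [← Real.rpow_mul hPpos.le, mul_one_div_cancel hδ.ne', Real.rpow_one] at h4

/-- **`ProductIneq → ProductForm`**: Szpiro's inequality on Frey curves gives the counting piece
(with `ε = (1-3μ)/(2μ)`, a `μ`-product-exceptional triple has `c ≤ abc ≤ M(μ)`). -/
theorem productForm_of_productIneq (h : ProductIneq) : ProductForm := by
  intro μ hμ
  by_cases hμ0 : μ ≤ 0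
  · exact ⟨0, fun X => by rw [prodExcSet_eq_empty_of_nonpos hμ0 X, Set.ncard_empty]⟩
  push Not at hμ0
  set ε : ℝ := (1 - 3 * μ) / (2 * μ) with hε_def
  have hε : 0 < ε := div_pos (by linarith) (by linarith)
  have hμε : μ * (3 + ε) < 1 := by
    have hμ0' : μ ≠ 0 := hμ0.ne'
    have : μ * (3 + ε) = (1 + 3 * μ) / 2 := by
      rw [hε_def]; field_simp; ring
    rw [this]; linarith
  obtain ⟨C, hC⟩ := h ε hε
  set M : ℕ := ⌈C ^ (1 / (1 - μ * (3 + ε)))⌉₊ with hM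
  refine ⟨(prodExcSet μ M).ncard, fun X => Set.ncard_le_ncard ?_ (prodExcSet_finite μ M)⟩
  rintro ⟨a, b, c⟩ ⟨ht, -, hrad⟩
  refine ⟨ht, ?_, hrad⟩
  obtain ⟨ha, hb, habc', hcop⟩ := ht
  simp only at habc' hrad ⊢
  have habc0 : 0 < a * b * c := by
    have hc0 : 0 < c := by omega
    positivity
  have hlt := prod_lt_of_productIneq_of_exceptional habc0 (by linarith) hμε
    (hC a b c ⟨ha, hb, habc', hcop⟩) hrad
  have hcle : (c : ℝ) ≤ ((a * b * c : ℕ) : ℝ) := by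
    have : c ≤ a * b * c := Nat.le_mul_of_pos_left c (by positivity)
    exact_mod_cast this
  have : (c : ℝ) ≤ (M : ℝ) := (hcle.trans hlt.le).trans (Nat.le_ceil _)
  exact_mod_cast this

/-- **`ABC → ProductIneq`** (abc implies Szpiro for Frey curves): `abc < c³ < C³ rad^{3+3ε'}`. -/
theorem productIneq_of_ABC (habc : _root_.ABC) : ProductIneq := by
  intro ε hε
  obtain ⟨C, hC0, hC⟩ := habc (ε / 3) (by linarith)
  refine ⟨C ^ 3, fun a b c ht => ?_⟩
  obtain ⟨ha, hb, habc', hcop⟩ := ht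
  have hc := hC a b c ⟨ha, hb, habc', hcop⟩
  have hrad0 : (0 : ℝ) ≤ ((rad a b c : ℕ) : ℝ) := Nat.cast_nonneg _
  have hR : 0 ≤ C * ((rad a b c : ℕ) : ℝ) ^ (1 + ε / 3) :=
    mul_nonneg hC0.le (Real.rpow_nonneg hrad0 _)
  have hac : (a : ℝ) ≤ c := by exact_mod_cast (show a ≤ c by omega)
  have hbc : (b : ℝ) ≤ c := by exact_mod_cast (show b ≤ c by omega)
  have ha0 : (0 : ℝ) ≤ a := Nat.cast_nonneg _
  have hb0 : (0 : ℝ) ≤ b := Nat.cast_nonneg _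
  have hc0 : (0 : ℝ) ≤ c := Nat.cast_nonneg _
  have hcube : ((a * b * c : ℕ) : ℝ) ≤ (c : ℝ) * c * c := by
    push_cast
    gcongr
  have hexp3 : (1 + ε / 3) * ((3 : ℕ) : ℝ) = 3 + ε := by push_cast; ring
  have hpow : (C * ((rad a b c : ℕ) : ℝ) ^ (1 + ε / 3)) ^ (3 : ℕ)
      = C ^ 3 * ((rad a b c : ℕ) : ℝ) ^ (3 + ε) := by
    rw [mul_pow, ← Real.rpow_natCast (((rad a b c : ℕ) : ℝ) ^ (1 + ε / 3)) 3,
      ← Real.rpow_mul hrad0, hexp3]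
  calc ((a * b * c : ℕ) : ℝ) ≤ (c : ℝ) * c * c := hcube
    _ < (C * ((rad a b c : ℕ) : ℝ) ^ (1 + ε / 3)) ^ (3 : ℕ) := by
        have h3 : (c : ℝ) * c * c = (c : ℝ) ^ (3 : ℕ) := by ring
        rw [h3]
        exact pow_lt_pow_left₀ hc hc0 (by norm_num)
    _ = C ^ 3 * ((rad a b c : ℕ) : ℝ) ^ (3 + ε) := hpow

/-- Hence the Szpiro piece is a consequence of the summit (kernel-checked "weaker or equal"). -/
theorem productForm_of_ABC (habc : _root_.ABC) : ProductForm :=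
  productForm_of_productIneq (productIneq_of_ABC habc)

/-- … and so is the power-deep-sector piece. -/
theorem powerDeepForm_of_ABC (habc : _root_.ABC) : PowerDeepForm :=
  powerDeepForm_of_countingForm (countingForm_of_ABC habc)

end Summit.ABC.ABC.Cruxes.CountingForm.SplitCensus
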